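import Mathlib
import Summits.Ventures.HodgeRepro.Tier4.Target
import Summits.Ventures.HodgeRepro.Tier4.Line3.KMDatum
import Summits.Ventures.HodgeRepro.Tier4.Line3.KMDatumS

/-!
# Tier4/Line3/Defs — the DEFINITIONS of LINE L3, extracted verbatim from the line's skeleton (statement-only module)

Blind re-derivation cell `pub-hodge-repro`, Tier 4 «PROVE THE STEP» (README §9–§10).  Line L3 (planner t4-plan-3):
`Tier4/Line3/Skeleton.lean` v0.14, sha256 5b774b9a8f48f824d10bb62c4e4e18383ea9412af18a51e163cf606befcaa3f5, 1004 lines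
(HOME `proofs/t4-plan-3/Tier4/Line3/Skeleton-v0.14.lean`; «LINE L3 FILED» S12401).  Skeletons never go through the gate,
so the lemma modules of the line (`Tier4/Line3/<Lemma>.lean`, one registered statement each) need the line's DEFINED
objects in the tree: THIS module (filer t4-L3-p2, bus S12129 / S12179 / S12268 / S12327) is every `def` / `abbrev` /
`structure` / `attribute [instance]` of the skeleton — Part I (the assembly structures `OrbitExpansion`, `Localizer`,
`tail`), Part II-a (`T4Data` and its instances, `c`,
`Level`, `TrZ`, `integrand`, `domain`, `pairingZ`, `Tr`, `pairing`, `Tuple`, `orbitStep`, `gram`, `gramStep`, `Inv`),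
Part II-b (`lineStep`, `Line`, `LineTuple`, `rep`, `lines`, `orbitStepL`, `Orbit`, `orbitOf`, `inv`, `ballCoord`,
`theta`, `kernel`, `heckeAct`, `slot`, `coefQ`, `summand`, `term`, `IsLattice`, `InBall`), Part II-b′ (`classStep`,
`Class`, `classOf`, `MainClass`, `gRep`, `mainRep`, `stabCard`, `centerCard`, `classSum`), Part II-c (`gaussDef`,
`ThetaData`), `HeckeEquivariant`, and Part III's `Inputs` (`InBall`, `Loc`, `LocE` are in `Tier4/Line3/Localiser.lean`, the
lead's S12401 ask; Part I-b — `maj` and the sesquilinear datum — is t4-L3-p1's `Tier4/Line3/KMDatum.lean` +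
`Tier4/Line3/KMDatumS.lean`, bus S12411, imported here: the v0.14 identifiers `KMDatum` / `datum` / `datum_smul` read
`KMDatumS` / `datumS` / `datumS_smul` in this file, the ONLY deviation from the skeleton's bytes, applied to code lines
only and reversed by the generator's verification) — BYTE-IDENTICAL to the skeleton, in the same
order, in the same namespace `Summit.Ventures.HodgeRepro.Tier4.Line3`, with the skeleton's own docstrings and section
comments; every `theorem` of the skeleton is OMITTED here (the sorry-free ones are landed verbatim in
`Tier4/Line3/DefsLemmas.lean`; the `sorry` lemmas and their consumers `term_main_lower`, `line3_inputs`, `P_of_line`,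
`target_L3` are the line's items, landed one module each).  The skeleton remains the document of record for the
strategy (its module docstring).

Nothing here says anything about the status of the Hodge conjecture for CM abelian varieties, which is NOT proved
(HC_CM is NOT proved by anyone in this repository).
-/
set_option autoImplicit false

noncomputable section

namespace Summit.Ventures.HodgeRepro.Tier4.Line3

open Summit.Ventures.HodgeRepro.Tier4
open Matrix MeasureTheory NumberField
open Filter Topology
open scoped ComplexConjugate ComplexOrder

open scoped Classical

section Assembly

variable {Level : Type} {Tr : Level → Type}

/-- **ORBIT EXPANSION of the pairing** over a given type of orbits with a GIVEN family of orbital terms `term K γ o`: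
absolute convergence and the expansion identity at every level and every translate. -/
structure OrbitExpansion (Orbit : Type) (pairing : ∀ K : Level, Tr K → ℂ) (term : ∀ K : Level, Tr K → Orbit → ℂ) where
  /-- absolute convergence of the orbit expansion -/
  summable_norm : ∀ (K : Level) (γ : Tr K), Summable fun o => ‖term K γ o‖
  /-- the expansion identity `pairing K γ = Σ_orbits term K γ` -/
  expansion : ∀ (K : Level) (γ : Tr K), pairing K γ = ∑' o, term K γ o

namespace OrbitExpansion

variable {Orbit : Type} {pairing : ∀ K : Level, Tr K → ℂ} {term : ∀ K : Level, Tr K → Orbit → ℂ}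

/-- **LOCALISER**: a main orbit, depth-`N` levels and translates, the terms off the main orbit tend to `0`, the main
term stays bounded below, and one summable majorant dominates the terms OFF the main orbit at all depths (the main
term itself is not dominated: over a fundamental domain of growing level it grows). -/
structure Localizer (E : OrbitExpansion Orbit pairing term) where
  /-- the main orbit -/
  main : Orbit
  /-- the level of the depth-`N` localiser -/
  level : ℕ → Level
  /-- the depth-`N` localising translate, of level `level N` -/
  loc : ∀ N : ℕ, Tr (level N)
  /-- off the main orbit the localiser's terms tend to `0` -/
  tendsto_zero : ∀ o : Orbit, o ≠ main → Tendsto (fun N => term (level N) (loc N) o) atTop (𝓝 0)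
  /-- the main term is eventually bounded below -/
  main_lower : ∃ m : ℝ, 0 < m ∧ ∀ᶠ N in atTop, m ≤ ‖term (level N) (loc N) main‖
  /-- one summable majorant of the off-main terms for all depths -/
  bound : Orbit → ℝ
  bound_nonneg : ∀ o, 0 ≤ bound o
  bound_summable : Summable bound
  norm_term_le : ∀ (N : ℕ) (o : Orbit), o ≠ main → ‖term (level N) (loc N) o‖ ≤ bound o

namespace Localizer

variable {E : OrbitExpansion Orbit pairing term} (L : E.Localizer)

/-- The tail off the main orbit. -/
def tail (N : ℕ) : ℂ := ∑' o, if o = L.main then 0 else term (L.level N) (L.loc N) o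

end Localizer

end OrbitExpansion

end Assembly

/-! ## Part II — the objects of `P_T4`, the family of pairings they define, and the bridge to `P_T4`

`T4Data` bundles the `∀`-bound objects of `P_T4` with their hypotheses, verbatim.  Its levels are the congruence
subgroups `Γ′ ≤ Γ`; its Hecke quadruples of level `Γ′` (`TrZ`) are those of `P_T4`, with the pairing `pairingZ` = the
integral of `P_T4` over a chosen fundamental domain of `Γ′` (`∅` if none exists); the assembly's translates `Tr K` are
the finitely supported `ℂ`-combinations of Hecke quadruples (the localisers have complex coefficients) with the
`ℂ`-linearly extended `pairing`.  `exists_of_pairing_ne_zero` (sorry-free) turns a level and a combination with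
non-zero pairing into the existential of `P_T4`: some quadruple of the combination has non-zero pairing (finite-sum
logic), and its domain must be the chosen fundamental domain (the integral over `∅` is `0`). -/

/-- The objects of `P_T4` (the setting of TIER3.md §1 item 3, README §9), bundled with their hypotheses. -/
structure T4Data where
  /-- the CM field of the face -/
  F : Type
  [instFieldF : Field F]
  [instNumberFieldF : NumberField F]
  [instGaloisF : IsGalois ℚ F]
  [instCMF : IsCMField F]
  /-- the rank-four face -/
  T : Fin 4 → Finset (F →+* ℂ)
  hT : IsRankFourFace F T
  /-- the Galois CM field `E′ ⊇ F` of the hermitian space -/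
  E : Type
  [instFieldE : Field E]
  [instNumberFieldE : NumberField E]
  [instGaloisE : IsGalois ℚ E]
  [instCME : IsCMField E]
  hE : 2 ≤ Module.finrank ℚ (maximalRealSubfield E)
  ι : F →+* E
  /-- the hermitian form on `V = E′³` -/
  H : Matrix (Fin 3) (Fin 3) E
  hHerm : IsCHermitian (IsCMField.complexConj E).toRingEquiv H
  hAn : Anisotropic (IsCMField.complexConj E).toRingEquiv H
  /-- the embedding of signature `(2,1)` -/
  τ₀ : E →+* ℂ
  hDef : ∀ τ : E →+* ℂ, τ ≠ τ₀ → τ ≠ conjEmb τ₀ → IsDefinite (H.map τ)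
  /-- the Sylvester matrix -/
  C : Matrix (Fin 3) (Fin 3) ℂ
  hC : IsSylvester (H.map τ₀) C
  /-- the congruence subgroup of `X` -/
  Γ : Set (Matrix (Fin 3) (Fin 3) E)
  hΓ : IsCongruenceSubgroup (IsCMField.complexConj E).toRingEquiv H Γ
  /-- the embedding `s` -/
  s : F →+* ℂ
  /-- the corner lattices -/
  Λ : ∀ i : Fin 4, Submodule ℤ (↥(T i) → ℂ)
  [instDiscrete : ∀ i, DiscreteTopology (Λ i)]
  [instLattice : ∀ i, IsZLattice ℝ (Λ i)]
  hΛ : ∀ i, IsOFStable (T i) (Λ i)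
  /-- the Albanese lifts -/
  a : ∀ i : Fin 4, (Fin 2 → ℂ) → (↥(T i) → ℂ)
  ha : ∀ i, IsAlbaneseLift (T i) (Λ i) τ₀ C Γ (a i)
  /-- the labelling -/
  i₁ : Fin 4
  i₂ : Fin 4
  i₃ : Fin 4
  i₄ : Fin 4
  h₁₂ : i₁ ≠ i₂
  h₃₄ : i₃ ≠ i₄
  hs₁ : s ∈ T i₁
  hs₂ : s ∈ T i₂
  hs₃ : conjEmb s ∈ T i₃
  hs₄ : conjEmb s ∈ T i₄

attribute [instance] T4Data.instFieldF T4Data.instNumberFieldF T4Data.instGaloisF T4Data.instCMF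
  T4Data.instFieldE T4Data.instNumberFieldE T4Data.instGaloisE T4Data.instCME T4Data.instDiscrete
  T4Data.instLattice

namespace T4Data

variable (X : T4Data)

/-- the conjugation `c′` of `E′` -/
def c : X.E ≃+* X.E := (IsCMField.complexConj X.E).toRingEquiv

/-- LEVELS: the congruence subgroups `Γ′ ≤ Γ` (any level — deep level at any place is allowed, S11958 (i)). -/
def Level : Type :=
  {Γ' : Set (Matrix (Fin 3) (Fin 3) X.E) // IsCongruenceSubgroup X.c X.H Γ' ∧ Γ' ⊆ X.Γ}

/-- THE TRANSLATES OF `P_T4` at level `Γ′`: four Hecke elements of level `Γ′` (integer coefficients, as in `P_T4`). -/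
def TrZ (K : X.Level) : Type :=
  {h : Fin 4 → HeckeElement X.E // ∀ i, (h i).IsFor X.c X.H K.1}

/-- The integrand of `P_T4` for the Hecke elements `h`: `jac_s(T_{h_{i₁}} a_{i₁}, T_{h_{i₂}} a_{i₂}) ·
conj jac_{s̄}(T_{h_{i₃}} a_{i₃}, T_{h_{i₄}} a_{i₄})`. -/
def integrand (h : Fin 4 → HeckeElement X.E) (z : Fin 2 → ℂ) : ℂ :=
  jacDet (comp (X.T X.i₁) X.s X.hs₁ (heckeTranslate X.τ₀ X.C (h X.i₁) (X.a X.i₁)))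
         (comp (X.T X.i₂) X.s X.hs₂ (heckeTranslate X.τ₀ X.C (h X.i₂) (X.a X.i₂))) z *
  conj (jacDet (comp (X.T X.i₃) (conjEmb X.s) X.hs₃ (heckeTranslate X.τ₀ X.C (h X.i₃) (X.a X.i₃)))
               (comp (X.T X.i₄) (conjEmb X.s) X.hs₄ (heckeTranslate X.τ₀ X.C (h X.i₄) (X.a X.i₄))) z)

/-- A measurable fundamental domain of the level `K` that STAYS AWAY FROM THE BOUNDARY (`nsq ≤ r < 1` on it — a
relatively compact one), chosen; `∅` if none exists (v0.10, t4-L2-p1 S12231 (4)).  Such a domain exists exactly when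
`Γ′\𝔹` is compact (Godement / Borel–Harish-Chandra 1962 Thm 11.8 for the anisotropic `U(H)`): that printed input is
displayed ONCE, by the prover of L3.c, and nowhere else — L3.2a becomes a Weierstrass M-test on the compact
`{nsq ≤ r}` and the bridge `conclusion_of_pairingZ_ne_zero` is unchanged (a non-zero integral certifies the `if`-branch,
whose `choose_spec` carries `IsFundamentalDomainFor`). -/
def domain (K : X.Level) : Set (Fin 2 → ℂ) :=
  if hD : ∃ D : Set (Fin 2 → ℂ), IsFundamentalDomainFor (ballActions X.τ₀ X.C K.1) D ∧
      ∃ r : ℝ, r < 1 ∧ ∀ z ∈ D, nsq z ≤ r then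
    Classical.choose hD
  else ∅

/-- **THE PAIRING OF `P_T4`** of level `K` at the Hecke quadruple `h`: the integral of `P_T4` over the chosen domain
of `K` (`⟨f^*Ω_s, f^*Ω_{s̄}⟩_{L²(X_{Γ′})}` up to a non-zero constant, S11958). -/
def pairingZ (K : X.Level) (h : X.TrZ K) : ℂ :=
  ∫ z in X.domain K, X.integrand h.1 z

/-- TRANSLATES of level `K` for the assembly: finitely supported `ℂ`-combinations of Hecke quadruples of level `K`
(the localisers of step 3 are elements of the Hecke algebra with COMPLEX coefficients; `P_T4` only knows integer
ones, and the bridge below is the finite-sum logic). -/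
def Tr (K : X.Level) : Type := X.TrZ K →₀ ℂ

/-- The pairing extended `ℂ`-linearly to formal combinations: `pairing K (Σ c_h · h) = Σ c_h · pairingZ K h`. -/
def pairing (K : X.Level) (γ : X.Tr K) : ℂ :=
  Finsupp.sum γ fun h c => c * X.pairingZ K h

/-! ### The rational orbits of `V(E′)^4` and their Gram invariants (named objects of Target.lean) -/

/-- `V(E′)^4`: four vectors of `V = E′³`. -/
abbrev Tuple : Type := Fin 4 → Fin 3 → X.E

/-- One step of the rational symmetry: `x′ = t · (g x)` with `g ∈ U(H)(E′)` and `t ∈ (E′^1)^4`. -/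
def orbitStep (x x' : X.Tuple) : Prop :=
  ∃ g : Matrix (Fin 3) (Fin 3) X.E, IsUnitaryOf X.c X.H g ∧
    ∃ t : Fin 4 → X.E, (∀ j, X.c (t j) * t j = 1) ∧ ∀ j, x' j = t j • (g *ᵥ x j)

/-- The Gram matrix `T(x)_{ij} = ⟨x_i, x_j⟩_H`. -/
def gram (x : X.Tuple) : Matrix (Fin 4) (Fin 4) X.E := fun i j => hform X.c X.H (x i) (x j)

/-- One step of the torus action on Gram matrices: `T′_{ij} = c(t_i) t_j T_{ij}`. -/
def gramStep (T T' : Matrix (Fin 4) (Fin 4) X.E) : Prop :=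
  ∃ t : Fin 4 → X.E, (∀ j, X.c (t j) * t j = 1) ∧ ∀ i j, T' i j = X.c (t i) * t j * T i j

/-- **THE INVARIANTS**: Gram matrices modulo the torus. -/
def Inv : Type := Quot X.gramStep

end T4Data

namespace T4Data

variable (X : T4Data)

/-! ### II-b. THE CLASSICAL THETA OBJECTS ON THE BALL — all DEFINED over the objects of `P_T4` (lead S12007 (c))

The adelic picture of the strategy (steps 1–2) is written here CLASSICALLY, on the ball: a theta lift from `U(1)` with
datum `φ = φ_f ⊗ φ_∞` is, on `𝔹`, the series `Σ_{x ∈ V(E′)/E′^1} c(x) Φ(y(x), z)` where `c` (the `μ_f`-twisted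
`U(1)(𝔸_f)`-average of `φ_f`, restricted to the rational points) is the COEFFICIENT FUNCTION, `y(x) = C⁻¹τ₀(x)` the ball
coordinates of `x`, and `Φ(y, z)` the Kudla–Millson `(1,0)`-datum transported to `z`: a conjugate-linear form in `y` times the
Gaussian of the minimal majorant `(y,y)_z` (Bergeron, Produit, §3: Thm 3.3/3.4 and the Fock → Schrödinger dictionary;
Kudla–Millson IHÉS 71 p. 124: `ω(h)φ(x) = φ(h⁻¹x)`, polynomial Fock space).  The Hecke translate of the lift is the
lift of the Hecke-moved coefficient function (`heckeAct`); the quadruple integrand of `P_T4` is the series over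
`V(E′)^4/(E′^1)^4` of `coefQ · kernel`; the ORBITAL TERM of a rational orbit is the integral over the chosen fundamental
domain of the partial sum over that orbit.  None of these is a field of a structure: a degenerate instance is not
available. -/

/-- One step of the scaling by `E′^1`: `x′ = t • x` with `c(t) t = 1`. -/
def lineStep (x x' : Fin 3 → X.E) : Prop := ∃ t : X.E, X.c t * t = 1 ∧ x' = t • x

/-- `V(E′)/E′^1`: vectors modulo the norm-one scalars. -/
def Line : Type := Quot X.lineStep

/-- Quadruples of lines, `V(E′)^4/(E′^1)^4`. -/
abbrev LineTuple : Type := Fin 4 → X.Line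

/-- The chosen representative tuple of a line tuple. -/
def rep (w : X.LineTuple) : X.Tuple := fun j => Quot.out (w j)

/-- The line tuple of a tuple. -/
def lines (x : X.Tuple) : X.LineTuple := fun j => Quot.mk X.lineStep (x j)

/-- One step of `U(H)(E′)` on line tuples (through representatives; `g (t • x) = t • g x`). -/
def orbitStepL (w w' : X.LineTuple) : Prop :=
  ∃ g : Matrix (Fin 3) (Fin 3) X.E, IsUnitaryOf X.c X.H g ∧ ∀ j, w' j = Quot.mk X.lineStep (g *ᵥ Quot.out (w j))

/-- **THE RATIONAL ORBITS** of `(U(V) × U(1)^4)(E′)` on `V(E′)^4`: the `U(H)(E′)`-orbits of line tuples. -/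
def Orbit : Type := Quot X.orbitStepL

/-- The orbit of a line tuple. -/
def orbitOf (w : X.LineTuple) : X.Orbit := Quot.mk X.orbitStepL w

/-- **THE INVARIANT MAP**: the Gram class (Gram matrix modulo the torus) of the chosen representative. -/
def inv (o : X.Orbit) : X.Inv := Quot.mk X.gramStep (X.gram (X.rep (Quot.out o)))

/-- Ball coordinates `y(x) = C⁻¹ τ₀(x)` of a vector of `V(E′)`; `hform` becomes `± y^* J y` (`X.hC`). -/
def ballCoord (x : Fin 3 → X.E) : Fin 3 → ℂ := X.C⁻¹ *ᵥ fun i => X.τ₀ (x i)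

/-- The theta series of the coefficient function `c` with datum `Φ`: `Θ(z)_k = Σ_{lines} c(x) Φ(y(x), z)_k` (the summand
is a function of the line when `c` is `E′^1`-invariant — `ThetaData.weight` with `datum_smul`). -/
def theta (Φ : KMDatumS) (c : (Fin 3 → X.E) → ℂ) (z : Fin 2 → ℂ) (k : Fin 2) : ℂ :=
  ∑' o : X.Line, c (Quot.out o) * datumS Φ (X.ballCoord (Quot.out o)) z k

/-- The quadruple theta kernel `F(x, z) = (Φ(y x₀) ∧ Φ(y x₁))(z) · conj((Φ(y x₂) ∧ Φ(y x₃))(z))`. -/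
def kernel (Φ : KMDatumS) (x : X.Tuple) (z : Fin 2 → ℂ) : ℂ :=
  wedge (datumS Φ (X.ballCoord (x 0)) z) (datumS Φ (X.ballCoord (x 1)) z) *
    conj (wedge (datumS Φ (X.ballCoord (x 2)) z) (datumS Φ (X.ballCoord (x 3)) z))

/-- The Hecke action on coefficient functions: `(h · c)(x) = Σ_terms n · Σ_{r ∈ R} c(r x)` (the theta series of `h · c`
is the Hecke translate of the theta series of `c`: `pd_heckeTranslate`). -/
def heckeAct (h : HeckeElement X.E) (c : (Fin 3 → X.E) → ℂ) : (Fin 3 → X.E) → ℂ :=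
  fun x => (h.terms.map (fun t => t.1 • t.2.sum (fun r => c (r *ᵥ x)))).sum

/-- The slot → corner map: slots `0, 1` are the corners `i₁, i₂` (embedding `s`), slots `2, 3` the corners `i₃, i₄`
(embedding `s̄`). -/
def slot : Fin 4 → Fin 4 := ![X.i₁, X.i₂, X.i₃, X.i₄]

/-- The quadruple coefficient function of a `ℂ`-combination `γ` of Hecke quadruples, from the slot coefficient functions
`cf`: `Σ_k a_k (h_k · cf)(x₀)(h_k · cf)(x₁) · conj((h_k · cf)(x₂)(h_k · cf)(x₃))`. -/
def coefQ {K : X.Level} (cf : Fin 4 → (Fin 3 → X.E) → ℂ) (γ : X.Tr K) (x : X.Tuple) : ℂ :=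
  γ.sum fun h a => a * (X.heckeAct (h.1 (X.slot 0)) (cf 0) (x 0) * X.heckeAct (h.1 (X.slot 1)) (cf 1) (x 1)) *
    conj (X.heckeAct (h.1 (X.slot 2)) (cf 2) (x 2) * X.heckeAct (h.1 (X.slot 3)) (cf 3) (x 3))

/-- The summand of the quadruple series at a line tuple (torus-invariant for genuine data). -/
def summand (Φ : KMDatumS) (cf : Fin 4 → (Fin 3 → X.E) → ℂ) {K : X.Level} (γ : X.Tr K) (w : X.LineTuple)
    (z : Fin 2 → ℂ) : ℂ :=
  X.coefQ cf γ (X.rep w) * X.kernel Φ (X.rep w) z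

/-- **THE ORBITAL TERM** of the rational orbit `o` for the translates `γ` of level `K`:
`term K γ o = ∫_{D_K} Σ_{w ∈ o} coefQ(γ)(w) F(w, z) dz` — the contribution of the orbit to the integral over the chosen
fundamental domain of `K`. -/
def term (Φ : KMDatumS) (cf : Fin 4 → (Fin 3 → X.E) → ℂ) (K : X.Level) (γ : X.Tr K) (o : X.Orbit) : ℂ :=
  ∫ z in X.domain K, ∑' w : {w : X.LineTuple // X.orbitOf w = o}, X.summand Φ cf γ w.1 z

/-- `L ⊆ E′³` is an `𝒪_{E′}`-lattice: finitely generated and of full rank. -/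
def IsLattice (L : Submodule (NumberField.RingOfIntegers X.E) (Fin 3 → X.E)) : Prop :=
  L.FG ∧ Submodule.span X.E (L : Set (Fin 3 → X.E)) = ⊤

/-! ### II-b′. The `Γ′`-classes of the main orbit and THE CLASS SUM (v0.8)

Unfolding the orbital term of the main orbit over the fundamental domain (L3.6a) expresses it as the archimedean integral
`I_∞(xm) = ∫_𝔹 kernel(xm, z) dz` times a purely arithmetic CLASS SUM over the `Γ′`-classes of the main orbit: each class
has a representative `g_c • xm` with `g_c ∈ U(H)(E′)` (the torus is absorbed in the lines), contributes
`coefQ(g_c • xm)` (well defined on the class for the SYMMETRIC tuple: two choices differ by `t γ` with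
`t = (t₀, t₁, t₀, t₁)`, whose phase is `|τ₀ t₀ τ₀ t₁|² = 1`), and is weighted by `|Z′|/|Stab_{Γ′}(c)|` — the scalars of
`Γ′` act trivially on the ball and are counted once per map in the tiling, the stabiliser of the line tuple is finite
(norm-one elements of a fixed fractional ideal are finitely many up to the roots of unity).  The class sum is the
classical form of the global orbital integral of the localised coefficient system at `xm`; its Euler product is the
heart of the line (L3.3, clause `LocE.euler`). -/

/-- One step of `Γ′` on line tuples: `w′ = lines (γ • rep w)`. -/
def classStep (K : X.Level) (w w' : X.LineTuple) : Prop :=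
  ∃ γ ∈ K.1, w' = X.lines (fun j => γ *ᵥ X.rep w j)

/-- The `Γ′`-classes of line tuples. -/
def Class (K : X.Level) : Type := Quot (X.classStep K)

/-- The class of a line tuple. -/
def classOf (K : X.Level) (w : X.LineTuple) : X.Class K := Quot.mk (X.classStep K) w

/-- The classes of the MAIN orbit `[xm]` (the summation set of the class sum). -/
def MainClass (K : X.Level) (xm : X.Tuple) : Type :=
  {c : X.Class K // X.orbitOf (Quot.out c) = X.orbitOf (X.lines xm)}

/-- A unitary representative `g_c` of a main class, `lines (g_c • xm) ∈ c` (chosen; it exists for every class of the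
main orbit: `orbitStepL` is an equivalence relation since `U(H)(E′)` is a group — a support lemma of L3.6a). -/
def gRep (K : X.Level) (xm : X.Tuple) (c : X.MainClass K xm) : Matrix (Fin 3) (Fin 3) X.E :=
  if h : ∃ g : Matrix (Fin 3) (Fin 3) X.E, IsUnitaryOf X.c X.H g ∧
      X.classOf K (X.lines (fun j => g *ᵥ xm j)) = c.1 then Classical.choose h else 1

/-- The representative tuple `g_c • xm` of a main class. -/
def mainRep (K : X.Level) (xm : X.Tuple) (c : X.MainClass K xm) : X.Tuple := fun j => X.gRep K xm c *ᵥ xm j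

/-- The order of the stabiliser in `Γ′` of the line tuple of `x` (finite for the genuine objects; `Nat.card` is `0`
on an infinite type — finiteness is part of L3.6a's proof burden). -/
def stabCard (K : X.Level) (x : X.Tuple) : ℕ :=
  Nat.card {γ : Matrix (Fin 3) (Fin 3) X.E // γ ∈ K.1 ∧ X.lines (fun j => γ *ᵥ x j) = X.lines x}

/-- The number of scalar matrices in `Γ′` (the kernel of `Γ′ → ballActions`: a matrix acting trivially on the ball is
a scalar; the scalars of `U(H)(E′) ∩ GL_3(𝒪)` are roots of unity). -/
def centerCard (K : X.Level) : ℕ :=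
  Nat.card {γ : Matrix (Fin 3) (Fin 3) X.E // γ ∈ K.1 ∧ ∃ t : X.E, γ = t • (1 : Matrix (Fin 3) (Fin 3) X.E)}

/-- **THE CLASS SUM** of the main orbit: `S_K(γ) = Σ_{c ∈ [xm]/Γ′} (|Z′_K| / |Stab_{Γ′}(c)|) · coefQ γ (g_c • xm)`. -/
def classSum (cf : Fin 4 → (Fin 3 → X.E) → ℂ) {K : X.Level} (γ : X.Tr K) (xm : X.Tuple) : ℂ :=
  ∑' c : X.MainClass K xm,
    ((X.centerCard K : ℂ) / (X.stabCard K (X.mainRep K xm c) : ℂ)) * X.coefQ cf γ (X.mainRep K xm c)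

/-! ### II-c. The identification data (PRINTED INPUT) and the localisers -/

/-- **THE GAUSSIAN OF THE DEFINITE PLACES** `∏_{σ ≠ τ₀, τ̄₀} exp(−π |H_σ(σx, σx)|)` — the archimedean factor of the
coefficient function at the places where `U(H_σ)` is compact (v0.11).  It is `> 0`, invariant under `E′^1` (`|σ t| = 1`),
under `Γ` and under every rational element of `U(H)` (they are `H_σ`-unitary), so it passes through `heckeAct`
unchanged; the genuine coefficient function is `c_f · gaussDef` with `c_f` the adelic torus average (v0.13: no
local-constancy clause is stated — see the comment in `ThetaData`). -/
def gaussDef (x : Fin 3 → X.E) : ℝ :=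
  ∏ᶠ (σ : X.E →+* ℂ) (_ : σ ≠ X.τ₀ ∧ σ ≠ conjEmb X.τ₀),
    Real.exp (-(Real.pi * |(star (fun i => σ (x i)) ⬝ᵥ ((X.H.map σ) *ᵥ (fun i => σ (x i)))).re|))

/-- **THE IDENTIFICATION DATA** (the PRINTED input of step 1, packaged): a Kudla–Millson datum `Φ` and four coefficient
functions `cf j` (slot `j`) with the identification of the four eigen-`(1,0)`-forms `(a_i)^* dz_σ` as theta series
(`ident₀ … ident₃`), and the structural properties of the genuine data: `Γ`-invariance of the coefficients (the level),
`E′^1`-invariance (the summand is a function of the line), `U(2,1)`-equivariance of the datum (Kudla–Millson), local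
absolute convergence, the support of the coefficients in finitely many lattices up to the torus (the class number of
`U(1)`), and non-degeneracy of the datum (a non-zero wedge somewhere for independent first coordinates).  No field carries the
content of (P): the identification relates the GIVEN lifts `X.a` to the DEFINED series `X.theta`. -/
structure ThetaData where
  /-- the archimedean `(1,0)`-datum -/
  Φ : KMDatumS
  /-- the slot coefficient functions on `V(E′)` -/
  cf : Fin 4 → (Fin 3 → X.E) → ℂ
  /-- slot 0: `(a_{i₁})^* dz_s = θ(cf 0)` -/
  ident₀ : ∀ z ∈ ball, ∀ k, pd k (comp (X.T X.i₁) X.s X.hs₁ (X.a X.i₁)) z = X.theta Φ (cf 0) z k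
  /-- slot 1: `(a_{i₂})^* dz_s = θ(cf 1)` -/
  ident₁ : ∀ z ∈ ball, ∀ k, pd k (comp (X.T X.i₂) X.s X.hs₂ (X.a X.i₂)) z = X.theta Φ (cf 1) z k
  /-- slot 2: `(a_{i₃})^* dz_{s̄} = θ(cf 2)` -/
  ident₂ : ∀ z ∈ ball, ∀ k, pd k (comp (X.T X.i₃) (conjEmb X.s) X.hs₃ (X.a X.i₃)) z = X.theta Φ (cf 2) z k
  /-- slot 3: `(a_{i₄})^* dz_{s̄} = θ(cf 3)` -/
  ident₃ : ∀ z ∈ ball, ∀ k, pd k (comp (X.T X.i₄) (conjEmb X.s) X.hs₄ (X.a X.i₄)) z = X.theta Φ (cf 3) z k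
  /-- the coefficients are `Γ`-invariant -/
  invΓ : ∀ j, ∀ γ ∈ X.Γ, ∀ x, cf j (γ *ᵥ x) = cf j x
  /-- the coefficients are `E′^1`-INVARIANT (so that `c(x) Φ(y(x), z)` is a function of the line, with `datum_smul`);
  v0.14 — the torus character of type `−1` at `τ₀` is cancelled by the splitting character `χ_V` of the same type -/
  weight : ∀ j (t : X.E), X.c t * t = 1 → ∀ x, cf j (t • x) = cf j x
  /-- `U(2,1)`-equivariance of the datum as a `(1,0)`-form: `M^* Φ(M y) = Φ(y)` for every `M` unitary for `J` (untwisted: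
  `χ_W` trivial; the scalar `M = ζ·1` acts trivially on the ball, so this forces scalar weight `0` — satisfied by the
  sesquilinear shape and, e.g., by `∂_z e^{−π maj}` through the chain rule and `maj (M y) (M z) = maj y z`) -/
  equiv : ∀ M : Matrix (Fin 3) (Fin 3) ℂ, IsUnitaryOf (starRingAut : ℂ ≃+* ℂ) J M → ∀ (y : Fin 3 → ℂ) (z : Fin 2 → ℂ),
    z ∈ ball → ∀ l, (∑ k : Fin 2, datumS Φ (M *ᵥ y) (actM M z) k * pd l (fun w => actM M w k) z) = datumS Φ y z l
  /- NO local-constancy field (v0.13): `locconst` on `cf` (v0.7–v0.10, contradicted `decay`) and on `cf / gaussDef`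
  (v0.11–v0.12, contradicted `weight`: t4-crit-1 O4) both forced `cf ≡ 0`, and the genuine coefficient system is
  locally constant only ADELICALLY (a lattice translate `x + v` may acquire extra divisibility at a prime outside the
  level of the lattice, which changes the local torus factor there) — no lattice-periodicity clause is true of it;
  no lemma of the line consumes one. -/
  /-- absolute convergence of each theta series, LOCALLY UNIFORMLY on the ball (a summable majorant on every compact) -/
  summable : ∀ j (K : Set (Fin 2 → ℂ)), IsCompact K → K ⊆ ball → ∀ k, ∃ g : X.Line → ℝ, Summable g ∧
    ∀ z ∈ K, ∀ o : X.Line, ‖cf j (Quot.out o) * datumS Φ (X.ballCoord (Quot.out o)) z k‖ ≤ g o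
  /-- Gaussian decay at every DEFINITE embedding, polynomial growth in the ball coordinates (the coefficient function
  carries the Gaussians of the definite places — `gaussDef`, bounded by `exp (−c₀ Σ ‖σ x_i‖²)` since `H_σ` is definite —
  and the content of the vector; v0.7) -/
  decay : ∃ C e c₀ : ℝ, 0 < c₀ ∧ ∀ j x, ∀ σ : X.E →+* ℂ, σ ≠ X.τ₀ → σ ≠ conjEmb X.τ₀ →
    ‖cf j x‖ ≤ C * (1 + ‖X.ballCoord x‖) ^ e * Real.exp (-(c₀ * ∑ i, ‖σ (x i)‖ ^ 2))
  /-- up to the torus, the coefficients are supported in finitely many lattices -/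
  support : ∃ S : Finset (Submodule (NumberField.RingOfIntegers X.E) (Fin 3 → X.E)), (∀ L ∈ S, X.IsLattice L) ∧
    ∀ j x, cf j x ≠ 0 → ∃ t : X.E, X.c t * t = 1 ∧ ∃ L ∈ S, t • x ∈ L
  /-- non-degeneracy of the datum: two vectors with independent first ball coordinates have a non-zero wedge somewhere -/
  nondeg : ∀ a b : Fin 3 → ℂ, a 0 * b 1 - a 1 * b 0 ≠ 0 → ∃ z ∈ ball, wedge (datumS Φ a z) (datumS Φ b z) ≠ 0

/-! ### II-d. THE CONTENT LEMMAS — each about the DEFINED objects, each with its hypotheses displayed, each `sorry`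

L3.0 is the PRINTED input (not a prover item; lead S11958 (iii)).  L3.1–L3.7 are the prover items: none of them is
(P) in costume — each is closable without deciding `P_T4` (its conclusion is a property of `theta`, `term`, `kernel`
for the given data, not the non-vanishing of the pairing). -/

/-- HECKE EQUIVARIANCE of theta series for the datum `Φ`: for every corner `i`, embedding `σ ∈ T i` and coefficient
function `c` with the identification `(a_i)^* dz_σ = θ(c)` and the structural properties, the corner form of the Hecke
translate by any `h` of any level is the theta series of `h · c`. -/
def HeckeEquivariant (Φ : KMDatumS) : Prop :=
  ∀ (i : Fin 4) (σ : X.F →+* ℂ) (hσ : σ ∈ X.T i) (c : (Fin 3 → X.E) → ℂ),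
    (∀ z ∈ ball, ∀ k, pd k (comp (X.T i) σ hσ (X.a i)) z = X.theta Φ c z k) →
    (∀ γ ∈ X.Γ, ∀ x, c (γ *ᵥ x) = c x) →
    (∀ t : X.E, X.c t * t = 1 → ∀ x, c (t • x) = c x) →
    (∀ (K : Set (Fin 2 → ℂ)), IsCompact K → K ⊆ ball → ∀ k, ∃ g : X.Line → ℝ, Summable g ∧
      ∀ z ∈ K, ∀ o : X.Line, ‖c (Quot.out o) * datumS Φ (X.ballCoord (Quot.out o)) z k‖ ≤ g o) →
    ∀ (K : X.Level) (h : HeckeElement X.E), h.IsFor X.c X.H K.1 →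
      ∀ z ∈ ball, ∀ k, pd k (comp (X.T i) σ hσ (heckeTranslate X.τ₀ X.C h (X.a i))) z =
        X.theta Φ (X.heckeAct h c) z k

end T4Data

/-! ## Part III — the inputs assembled, the content theorem, and the target

`Inputs X` = the identification data, an orbit expansion of the pairing with THE defined orbital terms, and a localiser
of it.  `line3_inputs` is a THEOREM assembled from L3.0 (printed) and ALL of L3.1, L3.2a, L3.2, L3.3, L3.4, L3.5, L3.7, L3.6a,
L3.c (L3.1 and L3.2a enter as the hypotheses of L3.2, L3.7 as the hypothesis of L3.6, L3.6a + L3.c + L3.2a + `LocE.euler`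
through the PROVED L3.6 — every prover item is CONSUMED by the proof term of the assembly); `target_L3 : P_T4` is
sorry-free from it.  REMAINING `sorry`s (v0.10) = exactly the printed inputs L3.0 and L3.c, the prover items L3.1, L3.2a, L3.2,
L3.4, L3.5, L3.6a, L3.7, the heart L3.3, and the support cuts `witt_rank3` (L3.b, landed: p661377), `local_orbit_bounded`
(L3.d, landed: p661165 commit 001955738fe6), `datum_smul` (L3.e) — the three support cuts are OFF the DAG of `target_L3`. -/

/-- **The inputs of line L3** on the objects of `P_T4`. -/
structure Inputs (X : T4Data) where
  /-- the identification data (L3.0) -/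
  D : X.ThetaData
  /-- the orbit expansion of the pairing with the defined orbital terms (L3.2) -/
  expansion : OrbitExpansion X.Orbit X.pairing (X.term D.Φ D.cf)
  /-- a localiser of that expansion (L3.3–L3.6) -/
  localizer : expansion.Localizer

end Summit.Ventures.HodgeRepro.Tier4.Line3

end
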